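import Literature.NumberTheory.Sieve.LargeGapsCoveringTransfer
import HarnessLib

/-!
# Large gaps between primes: comparison lemmas for Rankin's rate, FGKT Theorem 1 ⇒ every Rankin
# constant, and Maynard's `limsup` form (Maynard 2016, Theorem 1) from the `G(X)` form

Topic `Literature/NumberTheory/Sieve`. Everything in this file is PROVED.

The ladder `LargeGapsBetweenPrimes.lean` renders the large-gap theorems in two printed shapes:
the `G(X)` shape ("for all large `X` there are consecutive primes `p_{n+1} ≤ X` with
`p_{n+1} − p_n ≥ c · rate(X)`": `HasPrimeGap`, `RankinConstant`, FGKMT 2018 Theorem 1), the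
composite-run shape (FGKT 2016 Theorem 1: `HasCompositeRun`), and Maynard's `limsup` shape
(`Maynard2016_theorem1`: "`p_{n+1} − p_n ≥ t · rate(p_n)` for infinitely many `n`", every `t`).
Passing between them needs two elementary comparison facts about Rankin's rate
`R(X) = log X log₂ X log₄ X/(log₃ X)²`, which is not monotone term-by-term (the `(log₃ X)^{-2}`):

* `rankinRate_le_two_mul`: **quasi-monotonicity** `R(u) ≤ 2 R(v)` for `eᵉ^ᵉ ≤ u ≤ v`
  (from `(1 + log q)² ≤ 2q`, `q = log₂ v/log₂ u ≥ 1`, i.e. `1 + x + x²/2 ≤ eˣ`);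
* `rankinRate_le_eight_mul_of_le_sq`: **doubling** `R(v) ≤ 8 R(u)` for `u ≤ v ≤ u²`, `u` large.

Consequences (all PROVED):

* `rankinConstant_of_fgkt2016_theorem1`: FGKT 2016 Theorem 1 ⇒ `RankinConstant c` for every `c`
  ("Theorem 1 improves Rankin's bound: the constant may be taken arbitrarily large",
  [FordGreenKonyaginTao2016, p. 936]);
* `maynard2016_theorem1_of_rankinConstant`: (every Rankin constant) ⇒ **Maynard 2016, Theorem 1**
  in its printed `limsup` form; hence `maynard2016_theorem1_of_fgkt2016_theorem1`,
  `maynard2016_theorem1_of_fgkt2016_theorem2`, `maynard2016_theorem1_of_fgkmt2018_theorem1`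
  (Maynard: "Ford, Green, Konyagin and Tao have independently proved the same result",
  [Maynard2016LargeGaps, p. 1]).

With `LargeGapsCoveringTransfer.lean` this makes every gap-theorem fact of the ladder
(Westzynthius, Erdős, Rankin `∃ c`, Rankin `1/3`, Pintz, Maynard, FGKT Theorem 1, FGKMT Theorem 1) a
PROVED consequence of either covering fact `FordGreenKonyaginTao2016_theorem2` /
`FordGreenKonyaginMaynardTao2018_coveringBound`; the first three are proved outright
(`LargeGaps{Westzynthius,Erdos,Rankin}Proofs.lean`, `LargeGapsRankinViaMcCurley.lean`).

## References

* K. Ford, B. Green, S. Konyagin, T. Tao, *Large gaps between consecutive prime numbers*, Ann. of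
  Math. 183 (2016) 935–974, Theorem 1 and p. 936. [FordGreenKonyaginTao2016]
* J. Maynard, *Large gaps between primes*, Ann. of Math. 183 (2016) 915–933, Theorem 1 and p. 1.
  [Maynard2016LargeGaps]
* K. Ford, B. Green, S. Konyagin, J. Maynard, T. Tao, *Long gaps between primes*, J. Amer. Math.
  Soc. 31 (2018) 65–105, Theorem 1 and (1.1). [FordGreenKonyaginMaynardTao2018]
-/

open Filter Finset

namespace Literature.NumberTheory.Sieve

/-! ### Rankin's rate in nested-logarithm form -/

/-- `R(X) = log X · log log X · log log log log X/(log log log X)²`.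
[cite: FordGreenKonyaginTao2016, p. 936 (Rankin's function)] -/
theorem rankinRate_eq (X : ℝ) :
    rankinRate X = Real.log X * Real.log (Real.log X) *
      Real.log (Real.log (Real.log (Real.log X))) / Real.log (Real.log (Real.log X)) ^ 2 := by
  have i2 : Real.log^[2] X = Real.log (Real.log X) := by simp [Function.iterate_succ_apply']
  have i3 : Real.log^[3] X = Real.log (Real.log (Real.log X)) := by
    simp [Function.iterate_succ_apply']
  have i4 : Real.log^[4] X = Real.log (Real.log (Real.log (Real.log X))) := by
    simp [Function.iterate_succ_apply']
  rw [rankinRate, i2, i3, i4]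

/-- `log y ≥ T` from `exp T ≤ y`. [folklore] -/
private theorem le_log_of_exp_le {T y : ℝ} (h : Real.exp T ≤ y) : T ≤ Real.log y := by
  have := Real.log_le_log (Real.exp_pos T) h
  rwa [Real.log_exp] at this

/-! ### Quasi-monotonicity: `R(u) ≤ 2 R(v)` for `u ≤ v` -/

/-- Core inequality behind quasi-monotonicity, on the nested logarithms `a = log u ≤ a' = log v`,
`b = log a`, `c = log b ≥ 1`, `d = log c` (and primed): `a b d/c² ≤ 2 a' b' d'/c'²`, because
`c'² ≤ 2 (b'/b) c²` by `(1 + x)² ≤ 2eˣ` with `x = c' − c = log (b'/b)`. [folklore] -/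
private theorem rate_core_mono {a b c d a' b' c' d' : ℝ} (hb : b = Real.log a) (hc : c = Real.log b)
    (hd : d = Real.log c) (hb' : b' = Real.log a') (hc' : c' = Real.log b') (hd' : d' = Real.log c')
    (hae : Real.exp (Real.exp 1) ≤ a) (haa : a ≤ a') :
    a * b * d / c ^ 2 ≤ 2 * (a' * b' * d' / c' ^ 2) := by
  have ha0 : 0 < a := (Real.exp_pos _).trans_le hae
  have hbe : Real.exp 1 ≤ b := hb ▸ le_log_of_exp_le hae
  have hb0 : 0 < b := (Real.exp_pos _).trans_le hbe
  have hbb : b ≤ b' := by rw [hb, hb']; exact Real.log_le_log ha0 haa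
  have hb'0 : 0 < b' := by linarith
  have hc1 : 1 ≤ c := hc ▸ le_log_of_exp_le hbe
  have hc0 : 0 < c := by linarith
  have hcc : c ≤ c' := by rw [hc, hc']; exact Real.log_le_log hb0 hbb
  have hc'0 : 0 < c' := by linarith
  have hd0 : 0 ≤ d := hd ▸ Real.log_nonneg hc1
  have hdd : d ≤ d' := by rw [hd, hd']; exact Real.log_le_log hc0 hcc
  -- `x = c' - c = log (b'/b) ≥ 0`, `exp x = b'/b`
  have hx : c' - c = Real.log (b' / b) := by rw [hc, hc', Real.log_div hb'0.ne' hb0.ne']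
  have hx0 : 0 ≤ c' - c := by linarith
  have hq0 : 0 < b' / b := by positivity
  have hexp : Real.exp (c' - c) = b' / b := by rw [hx, Real.exp_log hq0]
  have hquad := Real.quadratic_le_exp_of_nonneg hx0
  rw [hexp] at hquad
  -- `c'² ≤ 2 (b'/b) c²`
  have hkey : c' ^ 2 ≤ 2 * (b' / b) * c ^ 2 := by
    have h1 : c' ≤ c * (1 + (c' - c)) := by nlinarith
    have h2 : c' ^ 2 ≤ (c * (1 + (c' - c))) ^ 2 := pow_le_pow_left₀ hc'0.le h1 2
    have h3 : (1 + (c' - c)) ^ 2 ≤ 2 * (b' / b) := by nlinarith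
    calc c' ^ 2 ≤ (c * (1 + (c' - c))) ^ 2 := h2
      _ = c ^ 2 * (1 + (c' - c)) ^ 2 := by ring
      _ ≤ c ^ 2 * (2 * (b' / b)) := mul_le_mul_of_nonneg_left h3 (sq_nonneg c)
      _ = 2 * (b' / b) * c ^ 2 := by ring
  have hbq : b * (b' / b) = b' := mul_div_cancel₀ _ hb0.ne'
  rw [← mul_div_assoc, div_le_div_iff₀ (by positivity) (by positivity)]
  have ha'0 : 0 < a' := by linarith
  have hmain : a * b' * d ≤ a' * b' * d' :=
    mul_le_mul (mul_le_mul_of_nonneg_right haa hb'0.le) hdd hd0 (by positivity)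
  calc a * b * d * c' ^ 2 ≤ a * b * d * (2 * (b' / b) * c ^ 2) :=
        mul_le_mul_of_nonneg_left hkey (by positivity)
    _ = 2 * (a * (b * (b' / b)) * d) * c ^ 2 := by ring
    _ = 2 * (a * b' * d) * c ^ 2 := by rw [hbq]
    _ ≤ 2 * (a' * b' * d') * c ^ 2 :=
        mul_le_mul_of_nonneg_right (mul_le_mul_of_nonneg_left hmain zero_le_two) (sq_nonneg c)

/-- **Quasi-monotonicity of Rankin's rate**: `R(u) ≤ 2 R(v)` whenever `exp (exp (exp 1)) ≤ u ≤ v`.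
(The rate is eventually increasing; the factor `2` is what the transfers below need and has a
three-line proof from `1 + x + x²/2 ≤ eˣ`.) [cite: FordGreenKonyaginTao2016, p. 936 (Rankin's function)] -/
theorem rankinRate_le_two_mul {u v : ℝ} (hu : Real.exp (Real.exp (Real.exp 1)) ≤ u)
    (huv : u ≤ v) : rankinRate u ≤ 2 * rankinRate v := by
  rw [rankinRate_eq, rankinRate_eq]
  have hu0 : 0 < u := (Real.exp_pos _).trans_le hu
  exact rate_core_mono rfl rfl rfl rfl rfl rfl (le_log_of_exp_le hu) (Real.log_le_log hu0 huv)

/-! ### Doubling: `R(v) ≤ 8 R(u)` for `u ≤ v ≤ u²` -/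

/-- Core inequality behind the doubling bound: with `a ≤ a' ≤ 2a` and `d ≥ 1` one has
`b' ≤ 2b`, `c ≤ c'`, `d' ≤ 2d`, hence `a' b' d'/c'² ≤ 8 · a b d/c²`. [folklore] -/
private theorem rate_core_double {a b c d a' b' c' d' : ℝ} (hb : b = Real.log a)
    (hc : c = Real.log b) (hd : d = Real.log c) (hb' : b' = Real.log a') (hc' : c' = Real.log b')
    (hd' : d' = Real.log c') (hae : Real.exp (Real.exp (Real.exp 1)) ≤ a) (haa : a ≤ a')
    (ha2 : a' ≤ 2 * a) :
    a' * b' * d' / c' ^ 2 ≤ 8 * (a * b * d / c ^ 2) := by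
  have hlog2 : Real.log 2 ≤ 1 := by
    have := Real.log_two_lt_d9; norm_num at this; linarith
  have ha0 : 0 < a := (Real.exp_pos _).trans_le hae
  have ha'0 : 0 < a' := by linarith
  have hbe : Real.exp (Real.exp 1) ≤ b := hb ▸ le_log_of_exp_le hae
  have hb0 : 0 < b := (Real.exp_pos _).trans_le hbe
  have hbb : b ≤ b' := by rw [hb, hb']; exact Real.log_le_log ha0 haa
  have hb'0 : 0 < b' := by linarith
  have hce : Real.exp 1 ≤ c := hc ▸ le_log_of_exp_le hbe
  have hc0 : 0 < c := (Real.exp_pos _).trans_le hce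
  have hcc : c ≤ c' := by rw [hc, hc']; exact Real.log_le_log hb0 hbb
  have hd1 : 1 ≤ d := hd ▸ le_log_of_exp_le hce
  have hdd : d ≤ d' := by rw [hd, hd']; exact Real.log_le_log hc0 hcc
  have hd'0 : 0 ≤ d' := by linarith
  have h1b : 1 ≤ b := by
    have : (1 : ℝ) ≤ Real.exp (Real.exp 1) := by
      have h := Real.add_one_le_exp (Real.exp 1); have h' := Real.exp_pos 1; linarith
    linarith
  have h1c : 1 ≤ c := by have h := Real.add_one_le_exp (1 : ℝ); linarith
  -- `b' ≤ 2b`, `c' ≤ 2c`, `d' ≤ 2d`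
  have hb2 : b' ≤ 2 * b := by
    have h1 : b' ≤ Real.log (2 * a) := by rw [hb']; exact Real.log_le_log ha'0 ha2
    rw [Real.log_mul (by norm_num) ha0.ne', ← hb] at h1
    linarith
  have hc2 : c' ≤ 2 * c := by
    have h1 : c' ≤ Real.log (2 * b) := by rw [hc']; exact Real.log_le_log hb'0 hb2
    rw [Real.log_mul (by norm_num) hb0.ne', ← hc] at h1
    linarith
  have hc'0 : 0 < c' := by linarith
  have hd2 : d' ≤ 2 * d := by
    have h1 : d' ≤ Real.log (2 * c) := by rw [hd']; exact Real.log_le_log hc'0 hc2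
    rw [Real.log_mul (by norm_num) hc0.ne', ← hd] at h1
    linarith
  have hnum : a' * b' * d' ≤ (2 * a) * (2 * b) * (2 * d) :=
    mul_le_mul (mul_le_mul ha2 hb2 hb'0.le (by positivity)) hd2 hd'0 (by positivity)
  calc a' * b' * d' / c' ^ 2 ≤ a' * b' * d' / c ^ 2 :=
        div_le_div_of_nonneg_left (by positivity) (by positivity) (pow_le_pow_left₀ hc0.le hcc 2)
    _ ≤ (2 * a) * (2 * b) * (2 * d) / c ^ 2 := div_le_div_of_nonneg_right hnum (sq_nonneg c)
    _ = 8 * (a * b * d / c ^ 2) := by ring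

/-- **Doubling bound for Rankin's rate**: `R(v) ≤ 8 R(u)` whenever
`exp (exp (exp (exp 1))) ≤ u ≤ v ≤ u²` (so `log v ≤ 2 log u`; in particular for `v = 2u`).
[cite: FordGreenKonyaginTao2016, p. 936 (Rankin's function)] -/
theorem rankinRate_le_eight_mul_of_le_sq {u v : ℝ}
    (hu : Real.exp (Real.exp (Real.exp (Real.exp 1))) ≤ u) (huv : u ≤ v) (hv : v ≤ u ^ 2) :
    rankinRate v ≤ 8 * rankinRate u := by
  rw [rankinRate_eq, rankinRate_eq]
  have hu0 : 0 < u := (Real.exp_pos _).trans_le hu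
  have hv0 : 0 < v := hu0.trans_le huv
  have ha2 : Real.log v ≤ 2 * Real.log u := by
    have := Real.log_le_log hv0 hv
    rwa [Real.log_pow, Nat.cast_ofNat] at this
  exact rate_core_double rfl rfl rfl rfl rfl rfl (le_log_of_exp_le hu) (Real.log_le_log hu0 huv) ha2

/-! ### FGKT 2016, Theorem 1 ⇒ every Rankin constant -/

/-- **FGKT 2016 Theorem 1 ⇒ `RankinConstant c` for every `c`** ("the constant in Rankin's bound may
be taken arbitrarily large"): a run of `≥ 8(c⁺+1) R(X/2)` composites below `X/2` is a prime gap
`≥ (c⁺+1) R(X) ≥ (c − ε) R(X)` below `X`, by the doubling bound. PROVED.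
[cite: FordGreenKonyaginTao2016, Theorem 1 and p. 936] -/
theorem rankinConstant_of_fgkt2016_theorem1 (h : FordGreenKonyaginTao2016_theorem1) (c : ℝ) :
    RankinConstant c := by
  intro ε hε
  have hhalf : Tendsto (fun X : ℝ => X / 2) atTop atTop :=
    tendsto_id.atTop_div_const (by norm_num)
  filter_upwards [hhalf.eventually (h (8 * (max c 0 + 1))),
    hhalf.eventually (eventually_ge_atTop (Real.exp (Real.exp (Real.exp (Real.exp 1))))),
    hhalf.eventually (tendsto_rankinRate_atTop.eventually_ge_atTop 1),
    tendsto_rankinRate_atTop.eventually_ge_atTop 0, eventually_ge_atTop (4 : ℝ)]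
    with X hX hX2 hr1 hr0 hX4
  obtain ⟨y, hy, hrun⟩ := hX
  have hc0 : 0 ≤ max c 0 := le_max_right _ _
  have hy1 : 1 ≤ y := by
    have h1 : (1 : ℝ) ≤ 8 * (max c 0 + 1) * rankinRate (X / 2) := by nlinarith
    exact_mod_cast h1.trans hy
  have hgap := hasPrimeGap_of_hasCompositeRun hrun hy1
  have h2X : 2 * (X / 2) = X := by ring
  rw [h2X] at hgap
  refine hgap.mono le_rfl ?_
  have hcomp : rankinRate X ≤ 8 * rankinRate (X / 2) :=
    rankinRate_le_eight_mul_of_le_sq hX2 (by linarith) (by nlinarith)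
  push_cast
  calc (c - ε) * rankinRate X ≤ (max c 0 + 1) * rankinRate X :=
        mul_le_mul_of_nonneg_right (by linarith [le_max_left c 0]) hr0
    _ ≤ (max c 0 + 1) * (8 * rankinRate (X / 2)) := mul_le_mul_of_nonneg_left hcomp (by positivity)
    _ = 8 * (max c 0 + 1) * rankinRate (X / 2) := by ring
    _ ≤ y := hy
    _ ≤ (y : ℝ) + 1 := by linarith

/-- Consistency: FGKT Theorem 1 re-derives Pintz's and Rankin's constants through the chain.
[folklore] -/
example (h : FordGreenKonyaginTao2016_theorem1) : Rankin1938_largeGaps :=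
  rankin1938_of_pintz1997 (pintz1997_of_rankinConstant (rankinConstant_of_fgkt2016_theorem1 h))

/-! ### Maynard 2016, Theorem 1 (the `limsup` form) from the `G(X)` form -/

/-- **(every Rankin constant) ⇒ Maynard 2016, Theorem 1** as printed
(`limsup_n (p_{n+1} − p_n)/R(p_n) = ∞`): given `t > 0` and `N`, take `X` large with a gap
`p_{n+1} − p_n ≥ 2t R(X)`, `p_{n+1} ≤ X`, and `2t R(X) > p_K` (`K ≥ N`, `p_K` past the
quasi-monotonicity threshold); then `n ≥ K` and `t R(p_n) ≤ 2t R(X)`. PROVED.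
[cite: Maynard2016LargeGaps, Theorem 1] -/
theorem maynard2016_theorem1_of_rankinConstant (h : ∀ c : ℝ, RankinConstant c) :
    Maynard2016_theorem1 := by
  intro t
  have hinf := Nat.infinite_setOf_prime
  have hmono : StrictMono (Nat.nth Nat.Prime) := Nat.nth_strictMono hinf
  have hle : ∀ n : ℕ, (n : ℝ) ≤ Nat.nth Nat.Prime n := fun n => by
    exact_mod_cast Nat.le_nth fun hf => absurd hf hinf
  have hp : Tendsto (fun n : ℕ => (Nat.nth Nat.Prime n : ℝ)) atTop atTop :=
    tendsto_atTop_mono hle tendsto_natCast_atTop_atTop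
  rcases le_or_gt t 0 with ht | ht
  · -- `t ≤ 0`: the inequality holds for all large `n`
    refine Filter.Eventually.frequently ?_
    filter_upwards [hp.eventually (tendsto_rankinRate_atTop.eventually_ge_atTop 0)] with n hn
    have hgap : (Nat.nth Nat.Prime n : ℝ) < Nat.nth Nat.Prime (n + 1) := by
      exact_mod_cast hmono (Nat.lt_succ_self n)
    nlinarith
  · rw [Filter.frequently_atTop]
    intro N
    obtain ⟨X, hX, hXbig⟩ := ((h (2 * t + 1) 1 one_pos).and
      ((tendsto_rankinRate_atTop.const_mul_atTop (by positivity : (0 : ℝ) < 2 * t)).eventually_ge_atTop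
        ((Nat.nth Nat.Prime (max N ⌈Real.exp (Real.exp (Real.exp 1))⌉₊) : ℝ) + 1))).exists
    obtain ⟨n, hnX, hgap⟩ := hX
    have h2t : (2 * t + 1 - 1) * rankinRate X = 2 * t * rankinRate X := by ring
    rw [h2t] at hgap
    have hpn0 : (0 : ℝ) ≤ Nat.nth Nat.Prime n := Nat.cast_nonneg _
    have hlt : Nat.nth Nat.Prime (max N ⌈Real.exp (Real.exp (Real.exp 1))⌉₊) <
        Nat.nth Nat.Prime (n + 1) := by
      have h1 : (Nat.nth Nat.Prime (max N ⌈Real.exp (Real.exp (Real.exp 1))⌉₊) : ℝ) <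
          Nat.nth Nat.Prime (n + 1) := by linarith
      exact_mod_cast h1
    have hKn : max N ⌈Real.exp (Real.exp (Real.exp 1))⌉₊ ≤ n :=
      Nat.lt_succ_iff.1 (hmono.lt_iff_lt.1 hlt)
    refine ⟨n, (le_max_left _ _).trans hKn, ?_⟩
    have hpK : Real.exp (Real.exp (Real.exp 1)) ≤ Nat.nth Nat.Prime n :=
      calc Real.exp (Real.exp (Real.exp 1)) ≤ (⌈Real.exp (Real.exp (Real.exp 1))⌉₊ : ℝ) :=
            Nat.le_ceil _
        _ ≤ ((max N ⌈Real.exp (Real.exp (Real.exp 1))⌉₊ : ℕ) : ℝ) := by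
            exact_mod_cast le_max_right _ _
        _ ≤ Nat.nth Nat.Prime (max N ⌈Real.exp (Real.exp (Real.exp 1))⌉₊) := hle _
        _ ≤ Nat.nth Nat.Prime n := by exact_mod_cast hmono.monotone hKn
    have hpnX : (Nat.nth Nat.Prime n : ℝ) ≤ X := by
      have h1 : (Nat.nth Nat.Prime n : ℝ) ≤ Nat.nth Nat.Prime (n + 1) := by
        exact_mod_cast hmono.monotone (Nat.le_succ n)
      linarith
    calc t * rankinRate (Nat.nth Nat.Prime n) ≤ t * (2 * rankinRate X) :=
          mul_le_mul_of_nonneg_left (rankinRate_le_two_mul hpK hpnX) ht.le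
      _ = 2 * t * rankinRate X := by ring
      _ ≤ _ := hgap

/-- **FGKT 2016 Theorem 1 ⇒ Maynard 2016 Theorem 1** (the two simultaneous Annals papers prove
"the same result" [Maynard2016LargeGaps, p. 1]; here the formal deduction of Maynard's `limsup`
phrasing from FGKT's). [cite: Maynard2016LargeGaps, Theorem 1 and p. 1] -/
theorem maynard2016_theorem1_of_fgkt2016_theorem1 (h : FordGreenKonyaginTao2016_theorem1) :
    Maynard2016_theorem1 :=
  maynard2016_theorem1_of_rankinConstant (rankinConstant_of_fgkt2016_theorem1 h)

/-- FGKT 2016 Theorem 2 (the covering bound) ⇒ Maynard 2016 Theorem 1.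
[cite: Maynard2016LargeGaps, Theorem 1 and p. 1] -/
theorem maynard2016_theorem1_of_fgkt2016_theorem2 (h : FordGreenKonyaginTao2016_theorem2) :
    Maynard2016_theorem1 :=
  maynard2016_theorem1_of_rankinConstant (rankinConstant_of_fgkt2016_theorem2 h)

/-- FGKMT 2018 Theorem 1 ⇒ Maynard 2016 Theorem 1 ("Theorem 1 implies (1.1) with the constant
replaced by any `R`"). [cite: FordGreenKonyaginMaynardTao2018, Theorem 1 and (1.1)] -/
theorem maynard2016_theorem1_of_fgkmt2018_theorem1 (h : FordGreenKonyaginMaynardTao2018_theorem1) :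
    Maynard2016_theorem1 :=
  maynard2016_theorem1_of_rankinConstant (rankinConstant_of_fgkmt h)

end Literature.NumberTheory.Sieve
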